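import Summits.QuantumAdvantage.AdviceFreeQNC0.LightDeviation
import HarnessLib

/-!
# Cell qa-qnc0 (rung F-Q1, density axis): FACET IDENTITY / FACET REDUCTION
# (planner qa-qnc0-p1 ROUND-12 §2.10 (xi-ab), `MassInequalityK.lean` v6 section Facet — statements VERBATIM —
# with the SUPPORT proofs `facetCode`, `facetIdentity`, `facetReduction`, `facetReductionFifteen`)

Odd level = two copies of the even level.  For a word `K0` on the `(m+1)`-cube and either facet `{u_i = b}`,
`K0 ∘ (insert b at i)` is a word on the `m`-cube.  PROVED here:

* `facetCode : ∀ m, FacetCode m` — every codeword of `C_{m+1}` restricts, on every facet, to a codeword of `C_m`: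
  an affine function composed with `Fin.insertNth i b` is affine (`Smolensky.comp_subst_mem_lowDeg`), `|u|`
  shifts by `[b]` on the facet (`wt_insertNth`), and the even triple is relabelled cyclically;
* `facetIdentity : ∀ m n, FacetIdentity m n` — `(m+1)·bracketExt_{m+1} = Σ_{i,b} bracketExt_m(facet i b)`:
  pure double counting (`Fin.insertNthEquiv`: every row lies in exactly `m+1` facets; the row norm `distC n`
  is untouched);
* `facetReduction : ∀ m, FacetReduction m` and `facetReductionFifteen : FacetReductionFifteen` — the
  composition: MI(m; C_{m+1}) at every optimum of `C_m` ⇒ MI(m+1) at the symmetric optimum, GIVEN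
  `FacetCode m`, `FacetOptBoth m`, `FacetIdentity m (m+1)` (the first and third now theorems).

WHAT THIS IS NOT: `FacetOptBoth 14` (both facets of the symmetric optimum of `C_15` optimal for `C_14` —
a finite weight-class count) and `MassIneqExtAt 14 15` (the conjecture) are NOT proved; `WeightedMIEight` is
proved separately (`WeightedMIEight.lean`); separation NOT moved.
-/

namespace Summit.QuantumAdvantage.AdviceFreeQNC0

open Finset
open Literature.Computability.MetaComplexity Literature.Computability.MetaComplexity.Smolensky

namespace MassInequality

/-! ## (xi-ab) FACET IDENTITY / FACET REDUCTION — statements VERBATIM (planner `MassInequalityK.lean` v6)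
For the symmetric optimum `K0` of `C_{m+1}` and either facet `{u_i = b}` of the row cube, `K0 ∘ (insert b at i)` is a codeword of
`C_m`; at ODD m+1 (7, 9, 11, 13, 15) BOTH facet restrictions are OPTIMAL for `C_m` (w(m+1,1) = 2·w(m,1)), at EVEN m+1 exactly one is.
Counting every row in its m+1 facets: `(m+1)·bracket_{m+1} = Σ_{i,b} bracket_m(facet i b)` with the row norm unchanged, hence
MI(15) ⟸ MI(14; C_15) exactly, and at m+1 = 8 the PROVED MI(7) (domination) yields the (8−|u|)-weighted MI. -/
section Facet
/-- restrict a row-cube function to the facet `{u : u i = b}` (coordinates `Fin m` via `Fin.insertNth`). -/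
def facetRestrict {m : ℕ} {β : Type} (i : Fin (m + 1)) (b : Bool) (F : (Fin (m + 1) → Bool) → β) :
    (Fin m → Bool) → β :=
  fun u' => F (Fin.insertNth i b u')

/-- FacetCode m: every codeword of `C_{m+1}` restricts, on every facet, to a codeword of `C_m` (finite fact; true because
`|u| mod 3` shifts uniformly on a facet and `T₂ = T₀ + T₁` is invariant under cyclic relabelling). -/
def FacetCode (m : ℕ) : Prop :=
  ∀ A : (Fin (m + 1) → Bool) → Bool, IsElim1 (m + 1) A → ∀ i b, IsElim1 m (facetRestrict i b A)

/-- FacetOptOdd m: for the symmetric optimum of `C_{m+1}`, BOTH facet restrictions are optimal for `C_m`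
(checked by weight-class counting at m+1 = 7, 9, 15; FALSE at m+1 = 8, 14 where only one facet is optimal). -/
def FacetOptBoth (m : ℕ) : Prop :=
  ∀ K0 : (Fin (m + 1) → Bool) → Bool, IsOpt1 (m + 1) K0 → IsSymPat K0 → ∀ i b, IsOpt1 m (facetRestrict i b K0)

/-- bracket with an EXTERNAL row norm: rows indexed by the m-cube, row values in an arbitrary cube `Fin n → Bool`, measured by `distC n`. -/
noncomputable def bracketExt (m n : ℕ) (K0 : (Fin m → Bool) → Bool) (D : (Fin m → Bool) → (Fin n → Bool) → Bool) : ℤ :=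
  (∑ u ∈ univ.filter (fun u : Fin m → Bool => K0 u = true), (distC n (D u) : ℤ)) -
    ∑ u ∈ univ.filter (fun u : Fin m → Bool => K0 u = false), (distC n (D u) : ℤ)

/-- MI(m; C_n) at K0: mass inequality for m-cube-indexed deviations whose columns are `C_m`-codewords but whose rows live in
`F^{2^n}` and are measured against `C_n`.  `MassIneqExtAt m m = MassIneqAt m` (same formula). CONJECTURE (n = m+1, m even). -/
def MassIneqExtAt (m n : ℕ) (K0 : (Fin m → Bool) → Bool) : Prop :=
  ∀ D : (Fin m → Bool) → (Fin n → Bool) → Bool, (∀ v, IsElim1 m (fun u => D u v)) → 0 ≤ bracketExt m n K0 D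

/-- the facet identity (pure double counting; each row lies in exactly m+1 facets). SUPPORT, provable now. -/
def FacetIdentity (m n : ℕ) : Prop :=
  ∀ (K0 : (Fin (m + 1) → Bool) → Bool) (D : (Fin (m + 1) → Bool) → (Fin n → Bool) → Bool),
    ((m + 1 : ℕ) : ℤ) * bracketExt (m + 1) n K0 D =
      ∑ i : Fin (m + 1), ((bracketExt m n (facetRestrict i false K0) (facetRestrict i false D)) +
                           (bracketExt m n (facetRestrict i true K0) (facetRestrict i true D)))

/-- FACET REDUCTION at odd level: MI(m; C_{m+1}) at every optimum of C_m  ⇒  MI(m+1) at the symmetric optimum. SUPPORT (from the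
three statements above; `bracketExt (m+1) (m+1) = bracket (m+1)` definitionally). -/
def FacetReduction (m : ℕ) : Prop :=
  FacetCode m → FacetOptBoth m → FacetIdentity m (m + 1) →
    (∀ K0' : (Fin m → Bool) → Bool, IsOpt1 m K0' → MassIneqExtAt m (m + 1) K0') →
      ∀ K0 : (Fin (m + 1) → Bool) → Bool, IsOpt1 (m + 1) K0 → IsSymPat K0 → MassIneqAt (m + 1) K0

/-- the m = 15 instance that feeds `MIChainFifteen`: MI(15) at the symmetric optimum ⟸ MI(14; C_15) at the optima of C_14. -/
def FacetReductionFifteen : Prop := FacetReduction 14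

/-- WEIGHTED MI at even level (m+1 = 8): only the facets `{u_i = false}` restrict to the optimum of C_7, so summing the PROVED
MI(7)-type inequality (domination certificate, valid for every subadditive row norm) over those 8 facets gives the
`(8 − |u|)`-weighted mass inequality — a PROVED consequence at m = 8 once `DomSeven` lands (statement here for n = 8). -/
def WeightedMIEight : Prop :=
  ∀ K0 : (Fin 8 → Bool) → Bool, IsOpt1 8 K0 → IsSymPat K0 → (∀ i, IsOpt1 7 (facetRestrict i false K0)) →
    ∀ D : (Fin 8 → Bool) → (Fin 8 → Bool) → Bool, ColsInC 8 D →
      0 ≤ ∑ i : Fin 8, bracketExt 7 8 (facetRestrict i false K0) (facetRestrict i false D)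

example : FacetReductionFifteen = FacetReduction 14 := rfl

end Facet

/-! ## Proofs -/

variable {m n : ℕ}

/-! ### `FacetCode` -/

/-- Degree does not go up under restriction to a facet (substitution of a constant for `x_i`). -/
theorem hasDeg_facetRestrict {d : ℕ} (i : Fin (m + 1)) (b : Bool) {F : (Fin (m + 1) → Bool) → Bool}
    (hF : HasDeg F d) : HasDeg (facetRestrict i b F) d := by
  unfold HasDeg facetRestrict at *
  refine comp_subst_mem_lowDeg (F := ZMod 2) (fun x : Fin m → Bool => Fin.insertNth i b x) (fun j => ?_) hF
  rcases Fin.eq_self_or_eq_succAbove i j with rfl | ⟨p, rfl⟩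
  · exact Or.inl ⟨b, fun x => Fin.insertNth_apply_same _ _ _⟩
  · exact Or.inr ⟨p, fun x => Fin.insertNth_apply_succAbove _ _ _ _⟩

/-- Weight on a facet: `|insert b at i| = |u'| + [b]`. -/
theorem wt_insertNth (i : Fin (m + 1)) (b : Bool) (u : Fin m → Bool) :
    wt (Fin.insertNth i b u) = wt u + (if b = true then 1 else 0) := by
  unfold wt
  rw [Finset.card_filter, Finset.card_filter, Fin.sum_univ_succAbove _ i, Fin.insertNth_apply_same]
  simp only [Fin.insertNth_apply_succAbove]
  ring

/-- **`FacetCode m` for every `m` — PROVED.** -/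
theorem facetCode (m : ℕ) : FacetCode m := by
  intro A hA i b
  obtain ⟨T, hT, hTe, hTA⟩ := hA
  refine ⟨fun r => facetRestrict i b (T ((r + (if b = true then 1 else 0)) % 3)), fun r => hasDeg_facetRestrict i b (hT _),
    fun u => ?_, fun u => ?_⟩
  · -- evenness: a cyclic relabelling of the triple
    have hev := hTe (Fin.insertNth i b u)
    unfold facetRestrict
    cases b
    · simpa using hev
    · simp only [if_true, show (0 + 1) % 3 = 1 from rfl, show (1 + 1) % 3 = 2 from rfl, show (2 + 1) % 3 = 0 from rfl]
      revert hev
      cases T 0 (Fin.insertNth i true u) <;> cases T 1 (Fin.insertNth i true u) <;>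
        cases T 2 (Fin.insertNth i true u) <;> decide
  · -- values: `|u|` shifts by `[b]` on the facet
    unfold facetRestrict
    beta_reduce
    rw [hTA, wt_insertNth, Nat.mod_add_mod]

/-! ### `FacetIdentity` -/

/-- `bracketExt` as a signed sum over all rows. -/
theorem bracketExt_eq_sum (m n : ℕ) (K0 : (Fin m → Bool) → Bool) (D : (Fin m → Bool) → (Fin n → Bool) → Bool) :
    bracketExt m n K0 D =
      ∑ u : Fin m → Bool, (if K0 u = true then (distC n (D u) : ℤ) else -(distC n (D u) : ℤ)) := by
  unfold bracketExt
  rw [Finset.sum_filter, Finset.sum_filter, ← Finset.sum_sub_distrib]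
  refine Finset.sum_congr rfl fun u _ => ?_
  cases K0 u <;> simp

/-- Every row of the `(m+1)`-cube lies in exactly one of the two facets `{u_i = false}`, `{u_i = true}`. -/
theorem sum_eq_sum_facets (i : Fin (m + 1)) (g : (Fin (m + 1) → Bool) → ℤ) :
    ∑ u : Fin (m + 1) → Bool, g u =
      (∑ u' : Fin m → Bool, g (Fin.insertNth i false u')) + ∑ u' : Fin m → Bool, g (Fin.insertNth i true u') := by
  rw [← Fintype.sum_equiv (Fin.insertNthEquiv (fun _ => Bool) i) (fun p => g (Fin.insertNth i p.1 p.2)) g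
    (fun _ => rfl), Fintype.sum_prod_type, Fintype.sum_bool, add_comm]

/-- **`FacetIdentity m n` for every `m, n` — PROVED** (double counting). -/
theorem facetIdentity (m n : ℕ) : FacetIdentity m n := by
  intro K0 D
  simp only [bracketExt_eq_sum, facetRestrict]
  have key : ∀ i : Fin (m + 1),
      (∑ u' : Fin m → Bool, (if K0 (Fin.insertNth i false u') = true then (distC n (D (Fin.insertNth i false u')) : ℤ)
          else -(distC n (D (Fin.insertNth i false u')) : ℤ))) +
        ∑ u' : Fin m → Bool, (if K0 (Fin.insertNth i true u') = true then (distC n (D (Fin.insertNth i true u')) : ℤ)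
          else -(distC n (D (Fin.insertNth i true u')) : ℤ)) =
      ∑ u : Fin (m + 1) → Bool, (if K0 u = true then (distC n (D u) : ℤ) else -(distC n (D u) : ℤ)) :=
    fun i => (sum_eq_sum_facets i (fun u => if K0 u = true then (distC n (D u) : ℤ) else -(distC n (D u) : ℤ))).symm
  simp only [key, sum_const, card_univ, Fintype.card_fin, nsmul_eq_mul]

/-! ### `FacetReduction` -/

/-- **`FacetReduction m` for every `m` — PROVED** (the composition; `bracketExt (m+1) (m+1) = bracket (m+1)` is `rfl`). -/
theorem facetReduction (m : ℕ) : FacetReduction m := by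
  intro hcode hopt hid hMI K0 hK hsym D hcols
  have hfac : ∀ i b, 0 ≤ bracketExt m (m + 1) (facetRestrict i b K0) (facetRestrict i b D) := fun i b =>
    hMI _ (hopt K0 hK hsym i b) _ fun v => hcode (fun u => D u v) (hcols v) i b
  have hsum := hid K0 D
  have hnn : 0 ≤ ((m + 1 : ℕ) : ℤ) * bracketExt (m + 1) (m + 1) K0 D := by
    rw [hsum]; exact sum_nonneg fun i _ => add_nonneg (hfac i false) (hfac i true)
  have hpos : (0 : ℤ) < ((m + 1 : ℕ) : ℤ) := by exact_mod_cast Nat.succ_pos m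
  have : 0 ≤ bracketExt (m + 1) (m + 1) K0 D := le_of_mul_le_mul_left (by simpa using hnn) hpos
  exact this

/-- The `m = 15` instance. -/
theorem facetReductionFifteen : FacetReductionFifteen := facetReduction 14

end MassInequality

end Summit.QuantumAdvantage.AdviceFreeQNC0
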